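import Literature.Analysis.ValidatedNumerics.MultiPrecisionInterval
import HarnessLib

/-!
# Multi-precision ball arithmetic at a power-of-two scale, and a fast certified `e^{iθ}`

Topic `Literature/Analysis/ValidatedNumerics`. A companion to `MultiPrecisionInterval.lean`
(intervals `MI`/`MC` with integer endpoints at an arbitrary scale `S`, outward rounding by integer
DIVISION by `S`). At the multi-thousand-bit precisions of the zeta certificates
(`ZetaCertifiedEvaluation.lean`: `~1500`–`2500` digits) the interval product costs four big
products and two big divisions, and the Taylor/argument-halving evaluation of `e^{iθ}` (`MC.expI`)
several thousand such operations per call. This file provides the standard cheaper device: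

* `FB` — a *ball* `⟨c, r⟩` standing for `{x : |x·2^Q − c| ≤ r}` at a power-of-two scale `2^Q`, with
  exact `add/sub/neg/mulNat`, and `mul`/`sqr`/`divNat` rounding by SHIFTS (`Int.shiftRight`) — one
  big product per ball product; every operation has its inclusion theorem (`FB.mem_*`);
* conversions `FB.toMI` (ball at scale `2^Q` → interval at scale `2^(Q-j)`), `FB.mem_toMI`;
* `FB.trigHorner` — Paterson–Stockmeyer/Horner evaluation of the even Taylor polynomials of
  `cos` (`o = 0`) and `sin x / x` (`o = 1`) in `u = x²`, `Σ_{j<I·m} (-1)^j u^j o!/(2j+o)!`, with about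
  `m + I` ball products instead of `I·m` (`trigHorner_exact`: the exact recursion equals that sum;
  `mem_trigHorner`: the ball recursion encloses the exact one);
* `FB.cosSin` — `(cos x, sin x)` for a ball `|x| ≤ 1` (Taylor remainder from `Complex.exp_bound`),
  `FB.double` — the angle-doubling step `(cos 2a, sin 2a) = (1 - 2 sin²a, 2 sin a cos a)`;
* **`MC.expIFast`** — a drop-in replacement of `MC.expI` at scales `S = 2^sb`: the same reduction
  modulo `2π` and the same enclosure statement (`MC.mem_expIFast`), evaluated as
  `cosSin` at the angle divided by `2^k` followed by `k` doublings, in balls at scale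
  `2^(sb+guard+k)`.

## Main definitions and results (namespace `Literature.Analysis.ValidatedNumerics.NumericsMP`)

* `FB`, `FB.mem`, `FB.mem_add/sub/neg/mul/sqr/mulNat/divNat/widen`, `FB.toMI`, `FB.mem_toMI`;
* `FB.trigHorner`, `FB.trigHorner_exact`, `FB.mem_trigHorner`; `FB.cosSin`, `FB.mem_cosSin`;
  `FB.double`, `FB.mem_double`; `FB.doubles`, `FB.mem_doubles`;
* `MC.expIFast`, **`MC.mem_expIFast`** —
  `MI.mem (2^sb) π piI → expIFast sb guard k m I piI Θ = some Y → MI.mem (2^sb) θ Θ →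
   MC.mem (2^sb) (exp (θ I)) Y`.

## References

* R. P. Brent, P. Zimmermann, *Modern Computer Arithmetic*, Cambridge Univ. Press (2010), §3.1
  (fixed-point/ball representations), §4.4.3 (Paterson–Stockmeyer), §4.3.1 (argument doubling).
  [BrentZimmermann2010]
* M. S. Paterson, L. J. Stockmeyer, *On the number of nonscalar multiplications necessary to
  evaluate polynomials*, SIAM J. Comput. 2 (1973), 60–66. [PatersonStockmeyer1973]
-/

open Finset

namespace Literature.Analysis.ValidatedNumerics.NumericsMP

/-! ### Rounding lemmas for floor division read in `ℝ` -/

/-- `⌊a/b⌋ ≤ a/b < ⌊a/b⌋ + 1` for integers, read in `ℝ`. [folklore] -/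
lemma int_fdiv_bounds (a : ℤ) {b : ℤ} (hb : 0 < b) :
    ((a / b : ℤ) : ℝ) ≤ (a : ℝ) / b ∧ (a : ℝ) / b < ((a / b : ℤ) : ℝ) + 1 := by
  have hbr : (0 : ℝ) < b := by exact_mod_cast hb
  refine ⟨Numerics.fdiv_le_div hb, ?_⟩
  rw [div_lt_iff₀ hbr]
  have h := Int.lt_ediv_add_one_mul_self a hb
  exact_mod_cast h

/-- `⌊a/b⌋ ≤ a/b < ⌊a/b⌋ + 1` for naturals, read in `ℝ`. [folklore] -/
lemma nat_fdiv_bounds (a : ℕ) {b : ℕ} (hb : 0 < b) :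
    ((a / b : ℕ) : ℝ) ≤ (a : ℝ) / b ∧ (a : ℝ) / b < ((a / b : ℕ) : ℝ) + 1 := by
  have hbr : (0 : ℝ) < b := by exact_mod_cast hb
  refine ⟨Nat.cast_div_le, ?_⟩
  rw [div_lt_iff₀ hbr]
  have h : a < (a / b + 1) * b := by rw [Nat.add_mul, one_mul]; exact Nat.lt_div_mul_add hb
  exact_mod_cast h

/-! ### Balls -/

/-- A real ball with integer centre at scale `2^Q`: `⟨c, r⟩` stands for `{x : |x·2^Q - c| ≤ r}`.
[folklore] -/
structure FB where
  /-- scaled centre -/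
  c : ℤ
  /-- radius in units of `2^{-Q}` -/
  r : ℕ
  deriving DecidableEq, Inhabited

namespace FB

/-- `x ∈ B` at scale `2^Q`. [folklore] -/
def mem (Q : ℕ) (x : ℝ) (B : FB) : Prop := |x * (2 : ℝ) ^ Q - B.c| ≤ B.r

/-- The exact number `c / 2^Q`. [folklore] -/
def exact (c : ℤ) : FB := ⟨c, 0⟩

/-- Sum (exact). [folklore] -/
def add (A B : FB) : FB := ⟨A.c + B.c, A.r + B.r⟩

/-- Difference (exact). [folklore] -/
def sub (A B : FB) : FB := ⟨A.c - B.c, A.r + B.r⟩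

/-- Negation (exact). [folklore] -/
def neg (A : FB) : FB := ⟨-A.c, A.r⟩

/-- Product with a natural number (exact). [folklore] -/
def mulNat (A : FB) (n : ℕ) : FB := ⟨A.c * n, A.r * n⟩

/-- `|x|·2^Q ≤ absUpper`. [folklore] -/
def absUpper (A : FB) : ℕ := A.c.natAbs + A.r

/-- Product at scale `2^Q` (one big product; rounding by shifts). [folklore] -/
def mul (Q : ℕ) (A B : FB) : FB :=
  ⟨(A.c * B.c) >>> Q, ((A.c.natAbs * B.r + B.c.natAbs * A.r + A.r * B.r) >>> Q) + 2⟩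

/-- Square at scale `2^Q`. [folklore] -/
def sqr (Q : ℕ) (A : FB) : FB :=
  ⟨(A.c * A.c) >>> Q, (((2 * A.c.natAbs + A.r) * A.r) >>> Q) + 2⟩

/-- Division by a positive natural number. [folklore] -/
def divNat (A : FB) (d : ℕ) : FB := ⟨A.c / d, A.r / d + 2⟩

/-- Widening of the radius. [folklore] -/
def widen (A : FB) (e : ℕ) : FB := ⟨A.c, A.r + e⟩

/-- From scale `2^Q` to the interval type `MI` at scale `2^(Q-j)` (`j ≤ Q`). [folklore] -/
def toMI (j : ℕ) (A : FB) : MI := ⟨(A.c - A.r) >>> j, ((A.c + A.r) >>> j) + 1⟩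

variable {Q : ℕ} {x y : ℝ} {A B : FB}

/-- [folklore] -/
lemma mem_def : mem Q x A ↔ |x * (2 : ℝ) ^ Q - A.c| ≤ A.r := Iff.rfl

/-- [folklore] -/
theorem mem_exact (Q : ℕ) (c : ℤ) : mem Q ((c : ℝ) / 2 ^ Q) (exact c) := by
  simp [mem, exact]

/-- [folklore] -/
theorem mem_add (hx : mem Q x A) (hy : mem Q y B) : mem Q (x + y) (add A B) := by
  simp only [mem, add, Int.cast_add, Nat.cast_add] at *
  calc |(x + y) * 2 ^ Q - (A.c + B.c)| = |(x * 2 ^ Q - A.c) + (y * 2 ^ Q - B.c)| := by ring_nf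
    _ ≤ |x * 2 ^ Q - A.c| + |y * 2 ^ Q - B.c| := abs_add_le _ _
    _ ≤ A.r + B.r := add_le_add hx hy

/-- [folklore] -/
theorem mem_neg (hx : mem Q x A) : mem Q (-x) (neg A) := by
  simp only [mem, neg, Int.cast_neg] at *
  calc |(-x) * 2 ^ Q - -(A.c : ℝ)| = |x * 2 ^ Q - A.c| := by
        rw [← abs_neg]; ring_nf
    _ ≤ A.r := hx

/-- [folklore] -/
theorem mem_sub (hx : mem Q x A) (hy : mem Q y B) : mem Q (x - y) (sub A B) := by
  have := mem_add hx (mem_neg hy)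
  simpa [sub, add, neg, sub_eq_add_neg] using this

/-- [folklore] -/
theorem mem_mulNat (hx : mem Q x A) (n : ℕ) : mem Q (x * n) (mulNat A n) := by
  simp only [mem, mulNat, Int.cast_mul, Int.cast_natCast, Nat.cast_mul] at *
  calc |x * n * 2 ^ Q - A.c * n| = |x * 2 ^ Q - A.c| * n := by
        rw [show x * n * 2 ^ Q - A.c * n = (x * 2 ^ Q - A.c) * n by ring, abs_mul, Nat.abs_cast]
    _ ≤ A.r * n := by gcongr

/-- [folklore] -/
theorem abs_le_absUpper (hx : mem Q x A) : |x| * 2 ^ Q ≤ (A.absUpper : ℝ) := by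
  simp only [mem, absUpper, Nat.cast_add, Nat.cast_natAbs, Int.cast_abs] at *
  have h2 : (0 : ℝ) < 2 ^ Q := by positivity
  calc |x| * 2 ^ Q = |x * 2 ^ Q| := by rw [abs_mul, abs_of_pos h2]
    _ = |(x * 2 ^ Q - A.c) + A.c| := by ring_nf
    _ ≤ |x * 2 ^ Q - A.c| + |(A.c : ℝ)| := abs_add_le _ _
    _ ≤ A.r + |(A.c : ℝ)| := by gcongr
    _ = |(A.c : ℝ)| + A.r := by ring

/-- [folklore] -/
theorem mem_widen (hx : mem Q x A) {x' : ℝ} {e : ℕ} (he : |x' - x| * 2 ^ Q ≤ e) :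
    mem Q x' (widen A e) := by
  simp only [mem, widen, Nat.cast_add] at *
  calc |x' * 2 ^ Q - A.c| = |(x' - x) * 2 ^ Q + (x * 2 ^ Q - A.c)| := by ring_nf
    _ ≤ |(x' - x) * 2 ^ Q| + |x * 2 ^ Q - A.c| := abs_add_le _ _
    _ ≤ e + A.r := by
        gcongr
        rwa [abs_mul, abs_of_pos (by positivity : (0:ℝ) < 2 ^ Q)]
    _ = A.r + e := by ring

/-- The key estimate behind `mul`: `|XY - ab| ≤ |a| r_b + |b| r_a + r_a r_b`. [folklore] -/
lemma abs_mul_sub_mul_le {X Y a b ra rb : ℝ} (ha : |X - a| ≤ ra) (hb : |Y - b| ≤ rb) :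
    |X * Y - a * b| ≤ |a| * rb + |b| * ra + ra * rb := by
  have hra : 0 ≤ ra := (abs_nonneg _).trans ha
  have hrb : 0 ≤ rb := (abs_nonneg _).trans hb
  have h1 : X * Y - a * b = (X - a) * (Y - b) + a * (Y - b) + b * (X - a) := by ring
  rw [h1]
  calc |(X - a) * (Y - b) + a * (Y - b) + b * (X - a)|
      ≤ |(X - a) * (Y - b)| + |a * (Y - b)| + |b * (X - a)| := abs_add_three _ _ _
    _ = |X - a| * |Y - b| + |a| * |Y - b| + |b| * |X - a| := by
        rw [abs_mul, abs_mul, abs_mul]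
    _ ≤ ra * rb + |a| * rb + |b| * ra := by
        gcongr
    _ = _ := by ring

/-- Casting helper: `((n : ℤ) : ℝ)`-valued `2^Q`. [folklore] -/
lemma cast_two_pow (Q : ℕ) : (((2 ^ Q : ℕ) : ℤ) : ℝ) = (2 : ℝ) ^ Q := by push_cast; ring

/-- [folklore] -/
theorem mem_mul (hx : mem Q x A) (hy : mem Q y B) : mem Q (x * y) (mul Q A B) := by
  rw [mem_def] at hx hy ⊢
  simp only [mul]
  have h2 : (0 : ℝ) < 2 ^ Q := by positivity
  set E : ℕ := A.c.natAbs * B.r + B.c.natAbs * A.r + A.r * B.r with hE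
  have hEr : (E : ℝ) = |(A.c : ℝ)| * B.r + |(B.c : ℝ)| * A.r + A.r * B.r := by
    rw [hE]; push_cast [Nat.cast_natAbs, Int.cast_abs]; ring
  have hprod := abs_mul_sub_mul_le hx hy
  rw [← hEr] at hprod
  -- centre: floor of (A.c * B.c) / 2^Q
  have hc := int_fdiv_bounds (A.c * B.c) (b := (2 ^ Q : ℕ)) (by positivity)
  rw [← Int.shiftRight_eq_div_pow] at hc
  rw [cast_two_pow] at hc
  -- radius: floor of E / 2^Q
  have hr := nat_fdiv_bounds E (b := 2 ^ Q) (by positivity)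
  rw [← Nat.shiftRight_eq_div_pow] at hr
  push_cast at hr
  set c' : ℤ := (A.c * B.c) >>> Q with hc'
  set r' : ℕ := E >>> Q with hr'
  have key : |x * y * 2 ^ Q - ((A.c * B.c : ℤ) : ℝ) / 2 ^ Q| ≤ (E : ℝ) / 2 ^ Q := by
    rw [show x * y * 2 ^ Q - ((A.c * B.c : ℤ) : ℝ) / 2 ^ Q =
      (x * 2 ^ Q * (y * 2 ^ Q) - (A.c : ℝ) * B.c) / 2 ^ Q by push_cast; field_simp]
    rw [abs_div, abs_of_pos h2]
    exact div_le_div_of_nonneg_right hprod h2.le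
  push_cast
  calc |x * y * 2 ^ Q - (c' : ℝ)|
      = |(x * y * 2 ^ Q - ((A.c * B.c : ℤ) : ℝ) / 2 ^ Q) + (((A.c * B.c : ℤ) : ℝ) / 2 ^ Q - c')| := by
        ring_nf
    _ ≤ |x * y * 2 ^ Q - ((A.c * B.c : ℤ) : ℝ) / 2 ^ Q| + |((A.c * B.c : ℤ) : ℝ) / 2 ^ Q - c'| :=
        abs_add_le _ _
    _ ≤ (E : ℝ) / 2 ^ Q + 1 := by
        refine add_le_add key ?_
        rw [abs_le]; constructor <;> linarith [hc.1, hc.2]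
    _ ≤ (r' : ℝ) + 2 := by linarith [hr.2]

/-- [folklore] -/
theorem mem_sqr (hx : mem Q x A) : mem Q (x ^ 2) (sqr Q A) := by
  have h := mem_mul hx hx
  have hE : sqr Q A = mul Q A A := by
    simp only [sqr, mul, FB.mk.injEq, true_and]
    congr 1; ring
  rw [hE, pow_two]
  exact h

/-- [folklore] -/
theorem mem_divNat (hx : mem Q x A) {d : ℕ} (hd : 0 < d) : mem Q (x / d) (divNat A d) := by
  rw [mem_def] at hx ⊢
  simp only [divNat]
  have hdr : (0 : ℝ) < d := by exact_mod_cast hd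
  have hc := int_fdiv_bounds A.c (b := (d : ℤ)) (by exact_mod_cast hd)
  have hr := nat_fdiv_bounds A.r hd
  push_cast at hc hr ⊢
  have key : |x / d * 2 ^ Q - (A.c : ℝ) / d| ≤ (A.r : ℝ) / d := by
    rw [show x / d * 2 ^ Q - (A.c : ℝ) / d = (x * 2 ^ Q - A.c) / d by field_simp]
    rw [abs_div, abs_of_pos hdr]
    exact div_le_div_of_nonneg_right hx hdr.le
  calc |x / d * 2 ^ Q - ((A.c / d : ℤ) : ℝ)|
      = |(x / d * 2 ^ Q - (A.c : ℝ) / d) + ((A.c : ℝ) / d - ((A.c / d : ℤ) : ℝ))| := by ring_nf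
    _ ≤ |x / d * 2 ^ Q - (A.c : ℝ) / d| + |(A.c : ℝ) / d - ((A.c / d : ℤ) : ℝ)| := abs_add_le _ _
    _ ≤ (A.r : ℝ) / d + 1 := by
        refine add_le_add key ?_
        rw [abs_le]; constructor <;> linarith [hc.1, hc.2]
    _ ≤ ((A.r / d : ℕ) : ℝ) + 2 := by linarith [hr.2]

/-- [folklore] -/
theorem mem_toMI (hx : mem Q x A) {j : ℕ} (hj : j ≤ Q) :
    MI.mem (2 ^ (Q - j)) x (toMI j A) := by
  rw [mem_def, abs_le] at hx
  simp only [toMI, MI.mem]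
  have h2j : (0 : ℝ) < 2 ^ j := by positivity
  have hsplit : (2 : ℝ) ^ Q = 2 ^ (Q - j) * 2 ^ j := by rw [← pow_add, Nat.sub_add_cancel hj]
  have hlo := int_fdiv_bounds (A.c - A.r) (b := (2 ^ j : ℕ)) (by positivity)
  have hhi := int_fdiv_bounds (A.c + A.r) (b := (2 ^ j : ℕ)) (by positivity)
  rw [← Int.shiftRight_eq_div_pow, cast_two_pow] at hlo hhi
  have hxS : x * (2 : ℝ) ^ (Q - j) = (x * 2 ^ Q) / 2 ^ j := by
    rw [hsplit]; field_simp
  push_cast at hlo hhi ⊢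
  rw [hxS]
  constructor
  · refine hlo.1.trans ?_
    rw [div_le_div_iff_of_pos_right h2j]; linarith [hx.1]
  · have : (x * 2 ^ Q) / 2 ^ j ≤ ((A.c : ℝ) + A.r) / 2 ^ j := by
      rw [div_le_div_iff_of_pos_right h2j]; linarith [hx.2]
    linarith [hhi.2]


/-! ### Paterson–Stockmeyer / Horner evaluation of the `cos` and `sin x / x` polynomials

With `u = x²`, `cos x ≈ Σ_{j<K} (-1)^j u^j/(2j)!` and `sin x ≈ x · Σ_{j<K} (-1)^j u^j/(2j+1)!`.
For `K = I·m` both sums are evaluated from the powers `u^0, …, u^m` by a Horner scheme in `u^m`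
whose coefficients are the short blocks `Σ_{l<m} (-1)^l u^l · a!/(a+2l)!`, `a = 2im + o`
(`o = 0` for `cos`, `o = 1` for `sin`), the factorial ratios being applied as divisions by the
small naturals `(a+1)(a+2)⋯(a+2l)` (`ascProd`). -/

/-- `ascProd a n = (a+1)(a+2)⋯(a+n)`. [folklore] -/
def ascProd (a : ℕ) : ℕ → ℕ
  | 0 => 1
  | n + 1 => ascProd a n * (a + 1 + n)

/-- [folklore] -/
lemma ascProd_pos (a : ℕ) : ∀ n, 0 < ascProd a n
  | 0 => Nat.one_pos
  | n + 1 => Nat.mul_pos (ascProd_pos a n) (by omega)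

/-- `a! · (a+1)⋯(a+n) = (a+n)!`. [folklore] -/
lemma factorial_mul_ascProd (a : ℕ) : ∀ n, a.factorial * ascProd a n = (a + n).factorial
  | 0 => by simp [ascProd]
  | n + 1 => by
    rw [ascProd, ← mul_assoc, factorial_mul_ascProd a n, show a + (n + 1) = (a + n) + 1 by ring,
      Nat.factorial_succ]
    ring

/-- The block `Σ_{l<L} (-1)^l u^l / ((a+1)⋯(a+2l))` (exact). [folklore] -/
noncomputable def blockR (a : ℕ) (u : ℝ) (L : ℕ) : ℝ :=
  ∑ l ∈ range L, (-1 : ℝ) ^ l * u ^ l / ascProd a (2 * l)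

/-- The block in balls: `pows[l] ∋ u^l`. [folklore] -/
def blockB (Q : ℕ) (pows : Array FB) (a : ℕ) : ℕ → FB
  | 0 => ⟨0, 0⟩
  | l + 1 =>
    let t := (pows.getD l default).divNat (ascProd a (2 * l))
    if l % 2 = 0 then (blockB Q pows a l).add t else (blockB Q pows a l).sub t

/-- The Horner recursion (exact): `h n i = block(2im+o) + (-1)^m u^m h (n-1) (i+1) / D`,
`D = (2im+o+1)⋯(2im+o+2m)`. [folklore] -/
noncomputable def hornerR (o m : ℕ) (u : ℝ) : ℕ → ℕ → ℝ
  | 0, _ => 0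
  | n + 1, i => blockR (2 * i * m + o) u m +
      (-1 : ℝ) ^ m * u ^ m * hornerR o m u n (i + 1) / ascProd (2 * i * m + o) (2 * m)

/-- The Horner recursion in balls (`Um ∋ u^m`). [folklore] -/
def hornerB (Q : ℕ) (pows : Array FB) (Um : FB) (o m : ℕ) : ℕ → ℕ → FB
  | 0, _ => ⟨0, 0⟩
  | n + 1, i =>
    let t := (mul Q Um (hornerB Q pows Um o m n (i + 1))).divNat (ascProd (2 * i * m + o) (2 * m))
    if m % 2 = 0 then (blockB Q pows (2 * i * m + o) m).add t
    else (blockB Q pows (2 * i * m + o) m).sub t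

/-- **Exactness of the Horner scheme**:
`hornerR o m u n i = Σ_{j < n·m} (-1)^j u^j (2im+o)! / (2im+o+2j)!`. [folklore] -/
theorem hornerR_exact (o m : ℕ) (u : ℝ) :
    ∀ n i, hornerR o m u n i =
      ∑ j ∈ range (n * m), (-1 : ℝ) ^ j * u ^ j * (2 * i * m + o).factorial / (2 * i * m + o + 2 * j).factorial
  | 0, i => by simp [hornerR]
  | n + 1, i => by
    rw [hornerR, hornerR_exact o m u n (i + 1), show (n + 1) * m = m + n * m by ring, sum_range_add]
    set a := 2 * i * m + o with ha
    have ha' : 2 * (i + 1) * m + o = a + 2 * m := by rw [ha]; ring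
    congr 1
    · -- the block
      unfold blockR
      refine sum_congr rfl fun l _ ↦ ?_
      have hD := factorial_mul_ascProd a (2 * l)
      have hpos : (0 : ℝ) < ascProd a (2 * l) := by exact_mod_cast ascProd_pos a (2 * l)
      have hf : (0 : ℝ) < (a + 2 * l).factorial := by exact_mod_cast Nat.factorial_pos _
      rw [div_eq_div_iff hpos.ne' hf.ne']
      have : ((a.factorial : ℕ) : ℝ) * (ascProd a (2 * l) : ℝ) = ((a + 2 * l).factorial : ℝ) := by
        exact_mod_cast hD
      calc (-1 : ℝ) ^ l * u ^ l * ((a + 2 * l).factorial : ℝ)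
          = (-1 : ℝ) ^ l * u ^ l * (((a.factorial : ℕ) : ℝ) * (ascProd a (2 * l) : ℝ)) := by rw [this]
        _ = _ := by ring
    · -- the tail
      rw [ha', Finset.mul_sum, Finset.sum_div]
      refine sum_congr rfl fun j _ ↦ ?_
      have hD := factorial_mul_ascProd a (2 * m)
      have hpos : (0 : ℝ) < ascProd a (2 * m) := by exact_mod_cast ascProd_pos a (2 * m)
      have hf1 : (0 : ℝ) < (a + 2 * m + 2 * j).factorial := by exact_mod_cast Nat.factorial_pos _
      have hf2 : (0 : ℝ) < (a + 2 * (m + j)).factorial := by exact_mod_cast Nat.factorial_pos _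
      have heq : (a + 2 * (m + j)).factorial = (a + 2 * m + 2 * j).factorial := by ring_nf
      have : ((a.factorial : ℕ) : ℝ) * (ascProd a (2 * m) : ℝ) = ((a + 2 * m).factorial : ℝ) := by
        exact_mod_cast hD
      rw [heq, ← this, pow_add, pow_add]
      field_simp

variable {Q : ℕ}

/-- Soundness of `blockB`. [folklore] -/
theorem mem_blockB {u : ℝ} {pows : Array FB} (a : ℕ) :
    ∀ L, (∀ l, l < L → mem Q (u ^ l) (pows.getD l default)) → mem Q (blockR a u L) (blockB Q pows a L)
  | 0, _ => by simp [blockR, blockB, mem]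
  | L + 1, h => by
    have ih := mem_blockB a L fun l hl ↦ h l (Nat.lt_succ_of_lt hl)
    have ht : mem Q (u ^ L / ascProd a (2 * L)) ((pows.getD L default).divNat (ascProd a (2 * L))) :=
      mem_divNat (h L (Nat.lt_succ_self L)) (ascProd_pos a (2 * L))
    simp only [blockB]
    unfold blockR at ih ⊢
    rw [sum_range_succ]
    split_ifs with hpar
    · have hev : (-1 : ℝ) ^ L = 1 := by
        obtain ⟨c, hc⟩ := Nat.even_iff.2 hpar; rw [hc, ← two_mul, pow_mul]; simp
      rw [hev, one_mul]
      exact mem_add ih ht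
    · have hodd : (-1 : ℝ) ^ L = -1 := by
        have : L % 2 = 1 := Nat.mod_two_ne_zero.1 hpar
        obtain ⟨c, hc⟩ := Nat.odd_iff.2 this; rw [hc, pow_succ, pow_mul]; simp
      rw [hodd, show ∑ l ∈ range L, (-1 : ℝ) ^ l * u ^ l / ascProd a (2 * l) + -1 * u ^ L / ascProd a (2 * L)
        = ∑ l ∈ range L, (-1 : ℝ) ^ l * u ^ l / ascProd a (2 * l) - u ^ L / ascProd a (2 * L) by ring]
      exact mem_sub ih ht

/-- Soundness of `hornerB`. [folklore] -/
theorem mem_hornerB {u : ℝ} {pows : Array FB} {Um : FB} (o m : ℕ)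
    (hp : ∀ l, l < m → mem Q (u ^ l) (pows.getD l default)) (hU : mem Q (u ^ m) Um) :
    ∀ n i, mem Q (hornerR o m u n i) (hornerB Q pows Um o m n i)
  | 0, i => by simp [hornerR, hornerB, mem]
  | n + 1, i => by
    have ih := mem_hornerB o m hp hU n (i + 1)
    have hb := mem_blockB (Q := Q) (u := u) (pows := pows) (2 * i * m + o) m hp
    have ht : mem Q (u ^ m * hornerR o m u n (i + 1) / ascProd (2 * i * m + o) (2 * m))
        ((mul Q Um (hornerB Q pows Um o m n (i + 1))).divNat (ascProd (2 * i * m + o) (2 * m))) :=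
      mem_divNat (mem_mul hU ih) (ascProd_pos _ _)
    simp only [hornerB, hornerR]
    split_ifs with hpar
    · have hev : (-1 : ℝ) ^ m = 1 := by
        obtain ⟨c, hc⟩ := Nat.even_iff.2 hpar; rw [hc, ← two_mul, pow_mul]; simp
      rw [hev, one_mul]
      exact mem_add hb ht
    · have hodd : (-1 : ℝ) ^ m = -1 := by
        have : m % 2 = 1 := Nat.mod_two_ne_zero.1 hpar
        obtain ⟨c, hc⟩ := Nat.odd_iff.2 this; rw [hc, pow_succ, pow_mul]; simp
      rw [hodd, show blockR (2 * i * m + o) u m + -1 * u ^ m * hornerR o m u n (i + 1) / ascProd (2 * i * m + o) (2 * m)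
        = blockR (2 * i * m + o) u m - u ^ m * hornerR o m u n (i + 1) / ascProd (2 * i * m + o) (2 * m) by ring]
      exact mem_sub hb ht

/-- The table `#[u^0, u^1, …, u^n]` in balls. [folklore] -/
def powsB (Q : ℕ) (U : FB) : ℕ → Array FB
  | 0 => #[exact ((2 : ℤ) ^ Q)]
  | n + 1 => let A := powsB Q U n; A.push (mul Q (A.getD n default) U)

/-- [folklore] -/
theorem powsB_spec {u : ℝ} {U : FB} (hU : mem Q u U) :
    ∀ n, (powsB Q U n).size = n + 1 ∧ ∀ l, l ≤ n → mem Q (u ^ l) ((powsB Q U n).getD l default)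
  | 0 => by
    refine ⟨rfl, fun l hl ↦ ?_⟩
    obtain rfl : l = 0 := Nat.le_zero.1 hl
    have := mem_exact Q ((2 : ℤ) ^ Q)
    rw [show (powsB Q U 0).getD 0 default = exact ((2 : ℤ) ^ Q) from rfl]
    convert this using 1
    push_cast; simp
  | n + 1 => by
    obtain ⟨hsz, hmem⟩ := powsB_spec hU n
    simp only [powsB]
    refine ⟨by simp [hsz], fun l hl ↦ ?_⟩
    rcases Nat.lt_succ_iff_lt_or_eq.1 (Nat.lt_succ_of_le hl) with hlt | heq
    · have hlt' : l < (powsB Q U n).size := by rw [hsz]; exact hlt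
      rw [Array.getD_eq_getD_getElem?, Array.getElem?_push_lt hlt', Option.getD_some]
      have := hmem l (Nat.lt_succ_iff.1 hlt)
      rwa [Array.getD_eq_getD_getElem?, getElem?_pos _ l hlt', Option.getD_some] at this
    · subst heq
      have hidx : ((powsB Q U n).push (mul Q ((powsB Q U n).getD n default) U))[n + 1]? =
          some (mul Q ((powsB Q U n).getD n default) U) := by
        rw [← hsz]; exact Array.getElem?_push_size
      rw [Array.getD_eq_getD_getElem?, hidx, Option.getD_some, pow_succ]
      exact mem_mul (hmem n le_rfl) hU

/-! ### `cos` and `sin` of a small ball, angle doubling -/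

/-- `(cos x, sin x)` for a ball `X ∋ x` at scale `2^Q` with `|x| ≤ 1` (checked), by the Taylor
polynomials of degree `< 2K`, `K = I·m`, plus one unit of radius for the remainder (the
arithmetic side condition guaranteeing `remainder ≤ 2^{-Q}` is checked; `none` otherwise).
[folklore] -/
def cosSin (Q m I : ℕ) (X : FB) : Option (FB × FB) :=
  let K := I * m
  let A := X.absUpper
  let a := Nat.log2 A + 1
  if 0 < K ∧ 0 < m ∧ A ≤ 2 ^ Q ∧ a ≤ Q ∧
      2 ^ Q * (2 * K + 1) ≤ (2 * K).factorial * (2 * K) * 2 ^ (2 * K * (Q - a)) then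
    let U := sqr Q X
    let pows := powsB Q U m
    let Um := pows.getD m default
    let C := hornerB Q pows Um 0 m I 0
    let S0 := hornerB Q pows Um 1 m I 0
    let S := mul Q X S0
    some (C.widen 1, S.widen 1)
  else none

/-- Angle doubling: from `(cos a, sin a)` to `(cos 2a, sin 2a) = (1 - 2 sin² a, 2 sin a cos a)`
(`one = 2^Q`). [folklore] -/
def double (Q : ℕ) (one : ℤ) (CS : FB × FB) : FB × FB :=
  ((exact one).sub ((sqr Q CS.2).mulNat 2), (mul Q CS.2 CS.1).mulNat 2)

/-- `k` doublings. [folklore] -/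
def doubles (Q : ℕ) (one : ℤ) : ℕ → FB × FB → FB × FB
  | 0, CS => CS
  | k + 1, CS => doubles Q one k (double Q one CS)

/-- Even/odd splitting of a sum over `range (2K)`. [folklore] -/
lemma sum_range_two_mul {M : Type*} [AddCommMonoid M] (f : ℕ → M) :
    ∀ K, ∑ j ∈ range (2 * K), f j = ∑ l ∈ range K, (f (2 * l) + f (2 * l + 1))
  | 0 => by simp
  | K + 1 => by
    rw [show 2 * (K + 1) = 2 * K + 1 + 1 by ring, sum_range_succ, sum_range_succ, sum_range_two_mul f K,
      sum_range_succ, add_assoc]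

/-- The Taylor polynomial of `e^{ix}` of even length splits into the `cos` and `sin` polynomials.
[folklore] -/
lemma exp_I_taylor_split (x : ℝ) (K : ℕ) :
    ∑ j ∈ range (2 * K), ((x : ℂ) * Complex.I) ^ j / (j.factorial : ℂ) =
      ((∑ l ∈ range K, (-1 : ℝ) ^ l * x ^ (2 * l) / (2 * l).factorial : ℝ) : ℂ) +
      ((∑ l ∈ range K, (-1 : ℝ) ^ l * x ^ (2 * l + 1) / (2 * l + 1).factorial : ℝ) : ℂ) * Complex.I := by
  rw [sum_range_two_mul]
  push_cast
  rw [Finset.sum_mul, ← Finset.sum_add_distrib]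
  refine sum_congr rfl fun l _ ↦ ?_
  have hI2 : ((x : ℂ) * Complex.I) ^ (2 * l) = (-1 : ℂ) ^ l * (x : ℂ) ^ (2 * l) := by
    rw [pow_mul, pow_mul, mul_pow, Complex.I_sq]; ring
  have hI3 : ((x : ℂ) * Complex.I) ^ (2 * l + 1) = (-1 : ℂ) ^ l * (x : ℂ) ^ (2 * l + 1) * Complex.I := by
    rw [pow_succ, hI2]; ring
  rw [hI2, hI3]
  ring

/-- Remainder of the even-length Taylor polynomials of `cos` and `sin` (`|x| ≤ 1`, `K ≥ 1`):
both errors are at most `|x|^{2K} (2K+1) / ((2K)! · 2K)`. [folklore] -/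
lemma cos_sin_taylor_remainder {x : ℝ} (hx : |x| ≤ 1) {K : ℕ} (hK : 0 < K) :
    |Real.cos x - ∑ l ∈ range K, (-1 : ℝ) ^ l * x ^ (2 * l) / (2 * l).factorial| ≤
        |x| ^ (2 * K) * ((2 * K + 1) / ((2 * K).factorial * (2 * K))) ∧
      |Real.sin x - ∑ l ∈ range K, (-1 : ℝ) ^ l * x ^ (2 * l + 1) / (2 * l + 1).factorial| ≤
        |x| ^ (2 * K) * ((2 * K + 1) / ((2 * K).factorial * (2 * K))) := by
  have hnorm : ‖(x : ℂ) * Complex.I‖ ≤ 1 := by simpa using hx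
  have hb := Complex.exp_bound hnorm (n := 2 * K) (by omega)
  rw [exp_I_taylor_split] at hb
  have hn : ‖(x : ℂ) * Complex.I‖ = |x| := by simp
  rw [hn] at hb
  set C := ∑ l ∈ range K, (-1 : ℝ) ^ l * x ^ (2 * l) / (2 * l).factorial
  set S := ∑ l ∈ range K, (-1 : ℝ) ^ l * x ^ (2 * l + 1) / (2 * l + 1).factorial
  have hre : (Complex.exp ((x : ℂ) * Complex.I) - ((C : ℂ) + (S : ℂ) * Complex.I)).re = Real.cos x - C := by
    simp [Complex.exp_ofReal_mul_I_re]
  have him : (Complex.exp ((x : ℂ) * Complex.I) - ((C : ℂ) + (S : ℂ) * Complex.I)).im = Real.sin x - S := by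
    simp [Complex.exp_ofReal_mul_I_im]
  have hbound : ‖Complex.exp ((x : ℂ) * Complex.I) - ((C : ℂ) + (S : ℂ) * Complex.I)‖ ≤
      |x| ^ (2 * K) * ((2 * K + 1) / ((2 * K).factorial * (2 * K))) := by
    refine hb.trans (le_of_eq ?_)
    push_cast
    ring
  constructor
  · rw [← hre]; exact (Complex.abs_re_le_norm _).trans hbound
  · rw [← him]; exact (Complex.abs_im_le_norm _).trans hbound

/-- **Soundness of `cosSin`.** [folklore] -/
theorem mem_cosSin {x : ℝ} {X : FB} {m I : ℕ} {CS : FB × FB} (h : cosSin Q m I X = some CS)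
    (hx : mem Q x X) : mem Q (Real.cos x) CS.1 ∧ mem Q (Real.sin x) CS.2 := by
  unfold cosSin at h
  simp only at h
  split_ifs at h with hc
  simp only [Option.some.injEq] at h
  subst h
  obtain ⟨hK, hm, hA, ha, hrem⟩ := hc
  set K := I * m with hKdef
  have h2 : (0 : ℝ) < 2 ^ Q := by positivity
  -- |x| ≤ A / 2^Q ≤ 1 and |x| < 2^a / 2^Q
  have hxA := abs_le_absUpper hx
  set A := X.absUpper with hAdef
  have habs1 : |x| ≤ 1 := by
    have : (A : ℝ) ≤ 2 ^ Q := by exact_mod_cast hA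
    nlinarith
  set a := Nat.log2 A + 1 with hadef
  have hAa : A < 2 ^ a := by rw [hadef]; exact Nat.lt_log2_self
  have hxa : |x| * 2 ^ Q ≤ 2 ^ a := le_trans hxA (by exact_mod_cast hAa.le)
  -- the polynomial parts
  have hU := mem_sqr hx
  obtain ⟨-, hpows⟩ := powsB_spec hU m
  have hp : ∀ l, l < m → mem Q ((x ^ 2) ^ l) ((powsB Q (sqr Q X) m).getD l default) :=
    fun l hl ↦ hpows l hl.le
  have hUm := hpows m le_rfl
  have hC0 := mem_hornerB 0 m hp hUm I 0
  have hS0 := mem_hornerB 1 m hp hUm I 0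
  rw [hornerR_exact] at hC0 hS0
  have hS1 := mem_mul hx hS0
  -- identify with the Taylor polynomials in `x`
  have hCeq : (∑ j ∈ range (I * m), (-1 : ℝ) ^ j * (x ^ 2) ^ j * ((2 * 0 * m + 0).factorial : ℝ) /
      ((2 * 0 * m + 0 + 2 * j).factorial : ℝ)) = ∑ l ∈ range K, (-1 : ℝ) ^ l * x ^ (2 * l) / (2 * l).factorial := by
    refine Finset.sum_congr rfl fun (l : ℕ) _ ↦ ?_
    rw [show 2 * 0 * m + 0 + 2 * l = 2 * l by ring, show 2 * 0 * m + 0 = 0 by ring, Nat.factorial_zero,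
      Nat.cast_one, mul_one, pow_mul x 2 l]
  have hSeq : x * (∑ j ∈ range (I * m), (-1 : ℝ) ^ j * (x ^ 2) ^ j * ((2 * 0 * m + 1).factorial : ℝ) /
      ((2 * 0 * m + 1 + 2 * j).factorial : ℝ)) =
      ∑ l ∈ range K, (-1 : ℝ) ^ l * x ^ (2 * l + 1) / (2 * l + 1).factorial := by
    rw [Finset.mul_sum]
    refine Finset.sum_congr rfl fun (l : ℕ) _ ↦ ?_
    rw [show 2 * 0 * m + 1 + 2 * l = 2 * l + 1 by ring, show 2 * 0 * m + 1 = 1 by ring, Nat.factorial_one,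
      Nat.cast_one, mul_one, pow_succ x (2 * l), pow_mul x 2 l]
    ring
  have hC := hC0
  rw [hCeq] at hC
  have hS := hS1
  rw [hSeq] at hS
  -- the remainder is at most one unit
  obtain ⟨hrc, hrs⟩ := cos_sin_taylor_remainder habs1 hK
  have hunit : |x| ^ (2 * K) * ((2 * K + 1) / ((2 * K).factorial * (2 * K))) * 2 ^ Q ≤ (1 : ℕ) := by
    -- from the checked inequality `2^Q (2K+1) ≤ (2K)! (2K) 2^{2K(Q-a)}` and `|x| ≤ 2^a/2^Q`
    have hxle : |x| ≤ (2 : ℝ) ^ a / 2 ^ Q := by rw [le_div_iff₀ h2]; exact hxa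
    have hpow : |x| ^ (2 * K) ≤ ((2 : ℝ) ^ a / 2 ^ Q) ^ (2 * K) :=
      pow_le_pow_left₀ (abs_nonneg x) hxle _
    have hfac : (0 : ℝ) < (2 * K).factorial * (2 * K) := by
      have : (0 : ℝ) < (2 * K).factorial := by exact_mod_cast Nat.factorial_pos _
      have : (0 : ℝ) < (2 * K : ℝ) := by exact_mod_cast (by omega : 0 < 2 * K)
      positivity
    have hremr : (2 : ℝ) ^ Q * (2 * K + 1) ≤ (2 * K).factorial * (2 * K) * 2 ^ (2 * K * (Q - a)) := by
      exact_mod_cast hrem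
    have hq : ((2 : ℝ) ^ a / 2 ^ Q) ^ (2 * K) = 1 / 2 ^ (2 * K * (Q - a)) := by
      rw [div_pow, ← pow_mul, ← pow_mul, show Q * (2 * K) = a * (2 * K) + 2 * K * (Q - a) by
        rw [show 2 * K * (Q - a) = (Q - a) * (2 * K) by ring, ← Nat.add_mul, Nat.add_sub_cancel' ha],
        pow_add]
      field_simp
    rw [hq] at hpow
    push_cast
    calc |x| ^ (2 * K) * ((2 * K + 1) / ((2 * K).factorial * (2 * K))) * 2 ^ Q
        ≤ (1 / 2 ^ (2 * K * (Q - a))) * ((2 * K + 1) / ((2 * K).factorial * (2 * K))) * 2 ^ Q := by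
          gcongr
      _ = (2 ^ Q * (2 * K + 1)) / ((2 * K).factorial * (2 * K) * 2 ^ (2 * K * (Q - a))) := by
          field_simp
      _ ≤ 1 := by
          rw [div_le_one (by positivity)]; exact hremr
  constructor
  · apply mem_widen hC
    calc |Real.cos x - ∑ l ∈ range K, (-1 : ℝ) ^ l * x ^ (2 * l) / (2 * l).factorial| * 2 ^ Q
        ≤ |x| ^ (2 * K) * ((2 * K + 1) / ((2 * K).factorial * (2 * K))) * 2 ^ Q :=
          mul_le_mul_of_nonneg_right hrc h2.le
      _ ≤ _ := hunit
  · apply mem_widen hS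
    calc |Real.sin x - ∑ l ∈ range K, (-1 : ℝ) ^ l * x ^ (2 * l + 1) / (2 * l + 1).factorial| * 2 ^ Q
        ≤ |x| ^ (2 * K) * ((2 * K + 1) / ((2 * K).factorial * (2 * K))) * 2 ^ Q :=
          mul_le_mul_of_nonneg_right hrs h2.le
      _ ≤ _ := hunit

/-- Soundness of `double` (`one = 2^Q`). [folklore] -/
theorem mem_double {a : ℝ} {CS : FB × FB} (hc : mem Q (Real.cos a) CS.1) (hs : mem Q (Real.sin a) CS.2) :
    mem Q (Real.cos (2 * a)) (double Q ((2 : ℤ) ^ Q) CS).1 ∧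
      mem Q (Real.sin (2 * a)) (double Q ((2 : ℤ) ^ Q) CS).2 := by
  simp only [double]
  constructor
  · have h1 : mem Q (1 : ℝ) (exact ((2 : ℤ) ^ Q)) := by
      have := mem_exact Q ((2 : ℤ) ^ Q); convert this using 1; push_cast; simp
    have h2 := mem_mulNat (mem_sqr hs) 2
    have := mem_sub h1 h2
    convert this using 1
    rw [Real.cos_two_mul, Real.cos_sq']; push_cast; ring
  · have := mem_mulNat (mem_mul hs hc) 2
    convert this using 1
    rw [Real.sin_two_mul]; push_cast; ring

/-- Soundness of `doubles`. [folklore] -/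
theorem mem_doubles {a : ℝ} :
    ∀ (k : ℕ) {CS : FB × FB}, mem Q (Real.cos a) CS.1 → mem Q (Real.sin a) CS.2 →
      mem Q (Real.cos (2 ^ k * a)) (doubles Q ((2 : ℤ) ^ Q) k CS).1 ∧
        mem Q (Real.sin (2 ^ k * a)) (doubles Q ((2 : ℤ) ^ Q) k CS).2
  | 0, CS, hc, hs => by simpa [doubles] using And.intro hc hs
  | k + 1, CS, hc, hs => by
    obtain ⟨hc2, hs2⟩ := mem_double hc hs
    have := mem_doubles k hc2 hs2
    simp only [doubles]
    rwa [show (2 : ℝ) ^ (k + 1) * a = 2 ^ k * (2 * a) by ring]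

end FB

/-! ### The fast `e^{iθ}` -/

namespace MC

/-- Enclosure of `{e^{iθ} : θ ∈ Θ}` at scale `S = 2^sb` — same reduction and statement as
`MC.expI`: reduce `θ₀ = lo Θ` modulo `2π` with the supplied `piI ∋ π` to `ψ ∈ θ₀I`, evaluate
`(cos, sin)` of `lo θ₀I / 2^k` in balls at scale `2^(sb+guard+k)` (`FB.cosSin`, blocks `m`,
`I`), double `k` times, convert to intervals at scale `2^sb`, and widen by the widths of `θ₀I`
and `Θ` (`|e^{iθ} - e^{iθ'}| ≤ |θ - θ'|`). [folklore] -/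
def expIFast (sb guard k m I : ℕ) (piI : MI) (Θ : MI) : Option MC :=
  let twoPi := piI.mulInt 2
  if 0 < twoPi.lo then
    let q : ℤ := (2 * Θ.lo + twoPi.lo) / (2 * twoPi.lo)
    let θ₀ : MI := (MI.ofScaled Θ.lo).sub (twoPi.mulInt q)
    let W := sb + guard + k
    let X : FB := ⟨θ₀.lo <<< guard, 0⟩
    match FB.cosSin W m I X with
    | some CS =>
        let CSk := FB.doubles W ((2 : ℤ) ^ W) k CS
        let Y : MC := ⟨CSk.1.toMI (guard + k), CSk.2.toMI (guard + k)⟩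
        some (Y.widen ((θ₀.hi - θ₀.lo) + (Θ.hi - Θ.lo)))
    | none => none
  else none

variable {sb : ℕ} {θ : ℝ} {Θ : MI}

/-- `e^{ia} ∈ ⟨C, S⟩` from `cos a ∈ C`, `sin a ∈ S`. [folklore] -/
lemma mem_exp_I_of_cos_sin {S : ℕ} {a : ℝ} {C Sn : MI} (hc : MI.mem S (Real.cos a) C)
    (hs : MI.mem S (Real.sin a) Sn) : mem S (Complex.exp ((a : ℂ) * Complex.I)) ⟨C, Sn⟩ := by
  constructor
  · simpa [Complex.exp_ofReal_mul_I_re] using hc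
  · simpa [Complex.exp_ofReal_mul_I_im] using hs

/-- **Soundness of `expIFast`.** [folklore] -/
theorem mem_expIFast {guard k m I : ℕ} {piI : MI} (hpi : MI.mem (2 ^ sb) Real.pi piI) {Y : MC}
    (h : expIFast sb guard k m I piI Θ = some Y) (hθ : MI.mem (2 ^ sb) θ Θ) :
    mem (2 ^ sb) (Complex.exp (θ * Complex.I)) Y := by
  set S : ℕ := 2 ^ sb with hSdef
  have hS : 0 < S := by positivity
  have hSr : (0 : ℝ) < S := by exact_mod_cast hS
  have hSne : (S : ℝ) ≠ 0 := hSr.ne'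
  unfold expIFast at h
  simp only at h
  split_ifs at h with hpos
  split at h
  · rename_i CS hCS
    simp only [Option.some.injEq] at h
    subst h
    set twoPi := piI.mulInt 2 with htwoPi
    set q : ℤ := (2 * Θ.lo + twoPi.lo) / (2 * twoPi.lo) with hq
    set θ₀I : MI := (MI.ofScaled Θ.lo).sub (twoPi.mulInt q) with hθ₀I
    set W := sb + guard + k with hW
    -- the reduced angle and its lower point
    set θ₀ : ℝ := (Θ.lo : ℝ) / S with hθ₀
    set ψ : ℝ := θ₀ - 2 * Real.pi * q with hψ
    have hψmem : MI.mem S ψ θ₀I := by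
      have h1 := MI.mem_ofScaled hS Θ.lo
      have h2 : MI.mem S (2 * Real.pi * q) (twoPi.mulInt q) := by
        have := MI.mem_mulInt (MI.mem_mulInt hpi 2) q
        push_cast at this
        rw [htwoPi]
        convert this using 1; ring
      exact MI.mem_sub h1 h2
    set ψlo : ℝ := (θ₀I.lo : ℝ) / S with hψlo
    set x : ℝ := ψlo / 2 ^ k with hx
    -- `x` is represented exactly at scale `2^W`
    have hxmem : FB.mem W x ⟨θ₀I.lo <<< guard, 0⟩ := by
      rw [FB.mem_def, Int.shiftLeft_eq]
      simp only [Nat.cast_zero]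
      rw [hx, hψlo, hW, hSdef, pow_add, pow_add]
      push_cast
      rw [show (θ₀I.lo : ℝ) / 2 ^ sb / 2 ^ k * (2 ^ sb * 2 ^ guard * 2 ^ k) - θ₀I.lo * 2 ^ guard = 0 by
        field_simp; ring]
      simp
    obtain ⟨hc, hs⟩ := FB.mem_cosSin hCS hxmem
    obtain ⟨hck, hsk⟩ := FB.mem_doubles k hc hs
    have h2kx : (2 : ℝ) ^ k * x = ψlo := by rw [hx]; field_simp
    rw [h2kx] at hck hsk
    have hjW : guard + k ≤ W := by rw [hW]; omega
    have hWj : W - (guard + k) = sb := by rw [hW]; omega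
    have hcM := FB.mem_toMI hck hjW
    have hsM := FB.mem_toMI hsk hjW
    rw [hWj] at hcM hsM
    have hY := mem_exp_I_of_cos_sin hcM hsM
    -- `e^{iθ} = e^{i(θ - 2πq)}` and `|θ - 2πq - ψlo| ≤ |θ - θ₀| + |ψ - ψlo|`
    have hper : Complex.exp ((θ : ℂ) * Complex.I) = Complex.exp (((θ - 2 * Real.pi * q : ℝ) : ℂ) * Complex.I) := by
      push_cast
      rw [sub_mul, Complex.exp_sub, show (2 * (Real.pi : ℂ) * (q : ℂ)) * Complex.I =
        (q : ℂ) * (2 * Real.pi * Complex.I) by ring, Complex.exp_int_mul_two_pi_mul_I, div_one]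
    rw [hper]
    apply mem_widen hY
    refine le_trans (mul_le_mul_of_nonneg_right
      (Literature.Analysis.ValidatedNumerics.Numerics.CB.norm_exp_I_sub_exp_I_le _ _) hSr.le) ?_
    have hθlo : θ₀ ≤ θ := by rw [hθ₀, div_le_iff₀ hSr]; exact hθ.1
    have hθhi : θ * S ≤ Θ.hi := hθ.2
    have hψ1 : ψlo ≤ ψ := by rw [hψlo, div_le_iff₀ hSr]; exact hψmem.1
    have hψ2 : ψ * S ≤ θ₀I.hi := hψmem.2
    have heq : θ - 2 * Real.pi * q - ψlo = (θ - θ₀) + (ψ - ψlo) := by rw [hψ]; ring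
    rw [heq, abs_of_nonneg (by linarith), add_mul, sub_mul, sub_mul, hθ₀, hψlo,
      div_mul_cancel₀ _ hSne, div_mul_cancel₀ _ hSne]
    have hθhi' : θ * (2 : ℝ) ^ sb ≤ Θ.hi := by rw [hSdef] at hθhi; exact_mod_cast hθhi
    have hψ2' : ψ * (2 : ℝ) ^ sb ≤ θ₀I.hi := by rw [hSdef] at hψ2; exact_mod_cast hψ2
    push_cast
    linarith
  · simp at h

end MC

end Literature.Analysis.ValidatedNumerics.NumericsMP
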